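/-
Copyright (c) 2026 the pub-hodgecm-mathlib formalisation cell (harness21).  Prover seat hodgecm-mathlib-K2E3-p11 (g10), Track B «K2-LIT», #184♮ = hLiu418 =
`stmt-HodgeConjecture-24832`; socket #41, KIND W, (KW-arch-hBL) brick (3d-iv) §B — KW desk F0P2-p08 (g4) RULING 2026-09-05T01:46:55Z «= K2E3-p11 pens (3d-iv)
`K2LiuKindWArchGrowthStabUniform :: stabUniform_of_atOne`».  THEOREMS ONLY (no `def`, no `instance`, no notation, no named-fact hypothesis, no `sorry`).
-/
import Summits.HodgeConjecture.HodgeConjecture.Theorems.K2LiuKindWArchStabPictures            -- ★ (3d-iv) §A (this seat)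
import Summits.HodgeConjecture.HodgeConjecture.Theorems.K2LiuKindWArchGrowthKUniform          -- ★ (3d-iii) K2E4-p10: `exists_basis_coeff_bound`
import Summits.HodgeConjecture.HodgeConjecture.Theorems.K2LiuKindWArchWhittakerGrowth         -- ★ FILE 2b LH4-p08: `levi_letters_unique`
import Summits.HodgeConjecture.HodgeConjecture.Theorems.K2LiuKindWArchBlockGrowthConversion   -- ★ (3c)-1 K2Liu-p11: `exp_neg_mul_le_of_le_mul`, `one_add_rpow_le_of_le_mul`
import Summits.HodgeConjecture.HodgeConjecture.Theorems.K2LiuArchPMinusCarrier                -- ★ `eq_of_isArchSiegelSection_of_eqOn_stab`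
import Summits.HodgeConjecture.HodgeConjecture.Theorems.K2LiuArchBlockOfFrameEnd              -- ★ `integrable_antidiag_transl`
import Summits.HodgeConjecture.HodgeConjecture.Theorems.K2LiuKindWArchWhittakerHolomorphy     -- ★ `norm_cexp_trace_hermOfReal` (the unimodular weight)
import HarnessLib

/-!
# Crux `HLiu418`, socket #41, KIND W — `K2LiuKindWArchGrowthStabUniform`: (3d-iv) §B, growth constants uniform over the stabiliser

Cell `hodgecm-mathlib`, crux item hLiu418 = `stmt-HodgeConjecture-24832` (helper lane `--supports … --as helper`, count-neutral).  (KW-arch-hBL) brick (3d-iv)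
«Stab-UNIFORMIZATION», the HEAD.  INPUT (BY VALUE, one alphabet for the three signs): an AT-ONE letter `hAtOne` — for every picture predicate `Pic` whose
`K`-translates are polynomial (`hKpic[Pic]`), a family of continuations `Ew hidx g` of the twisted unipotent integrals of the `Pic`-sections, holomorphic on
`{0 < re s}`, with the (ii″) growth face and constants `Cg cg N N′ r` depending on `(k, Pic, B, C, z)` ONLY, valid on the Siegel-form locus
`diag(C, −B)·g = n(X₀)·diag(R, R⁻¹)` (★ `K2LiuKindWArchWhittakerGrowthAtOnePic.exists_growth_constants_of_posDef_pic` at `sgn := PosDef`, ★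
`K2LiuKindWArchWhittakerGrowthAtOnePicNegDef.exists_growth_constants_of_negDef_pic` at `sgn h := (−h).PosDef`, LH4-p10's `…_of_indef_pic` at
`sgn h := hᴴ = h ∧ re det h < 0`).  OUTPUT: the `u₀`-FACE letter of ★ `K2LiuKindWArchGrowthFaceOfRecord.hWgrU_of_record` (`hPosU ∕ hNegU ∕ hIndU`, per datum
`(hidx, eb, g)`, constants first): growth on EVERY hermitian Iwasawa decomposition `diag(C, −B)·g = n(X₀)·diag(R, R⁻¹)·u₀`, `u₀ ∈ K = U(J) ∩ Stab(i1)`, with ONE set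
of constants.  PROOF (Shimura's compactness of `K`, made finite-dimensional): the `K`-picture of a `Q`-section is ONE polynomial `P₁` (★ W1 `kPicture_rightTranslate`
at `k₀ = 1`); its right translates `u ↦ P₁(u·k₀)` span a finite-dimensional space `V` (★ §A `totalDegree_bind₁_translate_le`) and move continuously with `k₀`, so ★
(3d-iii) `exists_basis_coeff_bound` gives a basis of `V` with coefficients bounded on the compact `K` (★ §A `isCompact_stab`); each basis vector is a finite
combination of translate pictures (`Submodule.mem_span_set'`), hence of finitely many translates `F(·κ_j)`, `κ_j ∈ K`; `hAtOne` at the translate predicates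
`Pic_j s F′ := ∃ F, F′ = F(·κ_j)` gives finitely many uniform letters `EwG_j`; at a datum `g` choose `diag(C,−B)·g = n·m·u₀` (★ `exists_transl_levi_mul_stabilizer`),
put `g′ := g·u₀ᴴ` (on the locus) and `Ew := Σ_j c_j(u₀)·EwG_j hidx g′`; the FORMULA follows because `F(·u₀)` and `Σ_j c_j(u₀)·F(·κ_j)` are sections with the same
`K`-picture (★ `eq_of_isArchSiegelSection_of_eqOn_stab`) and the twisted integral is linear (★ `integrable_antidiag_transl`); the BOUND is ★ §A
`exists_uniform_of_finite_family`, transported to any other decomposition `(X₀, R′, u₀′)` of the same `g` through ★ `levi_letters_unique` (`R = R′κ`, `κ` unitary: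
`‖det‖` and `‖det(R h₁ R)‖` invariant, `T₂` within a factor `4` — ★ §A §4, ★ `exp_neg_mul_le_of_le_mul`, ★ `one_add_rpow_le_of_le_mul`).
References: [Shimura1997] §16.4, §18.4; [KudlaRallis1994] §1; [BorelJacquet1979] §4.1.
HONEST LABEL.  Count-neutral helper; `HC_CM` is proved only modulo the 7 printed citations (2 remaining named inputs: hLiu418 = `stmt-HodgeConjecture-24832`,
h413 = `stmt-HodgeConjecture-24833`) until rung 0 closes.
-/

set_option autoImplicit false
set_option linter.dupNamespace false -- the mandated namespace repeats `HodgeConjecture.HodgeConjecture`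

noncomputable section

open Complex Matrix MeasureTheory
open scoped ComplexConjugate ComplexOrder

namespace Summit.HodgeConjecture.HodgeConjecture.Cruxes.HLiu418.K2LiuKindWArchGrowthStabUniform

open Literature.NumberTheory.ModularForms.SiegelUpperHalfSpace (moeb)
open Summit.HodgeConjecture.HodgeConjecture.Cruxes.HLiu418.K2LiuArchInducedTubeDefs
open Summit.HodgeConjecture.HodgeConjecture.Cruxes.HLiu418.K2LiuU22CompactPictureDefs
open Summit.HodgeConjecture.HodgeConjecture.Cruxes.HLiu418.K2LiuHermitianTubeCocycle (mul_mem_UJ transl_mem_iff)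
open Summit.HodgeConjecture.HodgeConjecture.Cruxes.HLiu418.K2LiuHermitianTubeAction (exists_transl_levi_mul_stabilizer)
open Summit.HodgeConjecture.HodgeConjecture.Cruxes.HLiu418.K2LiuArchBlockOfFrame (antidiag_letters)
open Summit.HodgeConjecture.HodgeConjecture.Cruxes.HLiu418.K2LiuArchBlockOfFrameEnd (integrable_antidiag_transl)
open Summit.HodgeConjecture.HodgeConjecture.Cruxes.HLiu418.K2LiuArchWhittakerLeviEquivariance (levi_mem isArchSiegelSection_rightTranslate)
open Summit.HodgeConjecture.HodgeConjecture.Cruxes.HLiu418.K2LiuArchPMinusCarrier (eq_of_isArchSiegelSection_of_eqOn_stab)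
open Summit.HodgeConjecture.HodgeConjecture.Cruxes.HLiu418.K2LiuKindWArchWhittakerKPicture (kPicture_rightTranslate)
open Summit.HodgeConjecture.HodgeConjecture.Cruxes.HLiu418.K2LiuKindWArchWhittakerGrowth (levi_letters_unique)
open Summit.HodgeConjecture.HodgeConjecture.Cruxes.HLiu418.K2LiuKindWArchWhittakerHolomorphy (norm_cexp_trace_hermOfReal)
open Summit.HodgeConjecture.HodgeConjecture.Cruxes.HLiu418.K2LiuKindWArchGrowthKUniform (exists_basis_coeff_bound)
open Summit.HodgeConjecture.HodgeConjecture.Cruxes.HLiu418.K2LiuKindWArchBlockGrowthConversion (exp_neg_mul_le_of_le_mul one_add_rpow_le_of_le_mul)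
open Summit.HodgeConjecture.HodgeConjecture.Cruxes.HLiu418.K2LiuKindWArchGrowthFaceOfRecord (le_sum_univ)
open Summit.HodgeConjecture.HodgeConjecture.Cruxes.HLiu418.K2LiuKindWArchStabPictures

/-- the twisted integrand of a `Q`-section at any `g ∈ U(J)` is integrable for `½ < re s` (★ `integrable_antidiag_transl` × the unimodular weight ★ `norm_cexp_trace_hermOfReal`). [cite: Shimura1997, §16.4] -/
theorem integrable_twisted (k : ℤ) {s : ℂ} (hs : 1 / 2 < s.re) {F : Matrix (Fin 2 ⊕ Fin 2) (Fin 2 ⊕ Fin 2) ℂ → ℂ}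
    (hF : IsArchSiegelSection (fun z : ℂ => (conj z / ((‖z‖ : ℝ) : ℂ)) ^ k) s F) (Q : Carrier)
    (hFQ : ∀ (v : Matrix (Fin 2) (Fin 2) ℂ), vᴴ * v = 1 → ∀ hv : v.det ≠ 0,
      F ((2 : ℂ)⁻¹ • fromBlocks (1 + v) (-(I • (1 - v))) (I • (1 - v)) (1 + v) : Matrix (Fin 2 ⊕ Fin 2) (Fin 2 ⊕ Fin 2) ℂ) = evalAt v hv Q)
    {B C : Matrix (Fin 2) (Fin 2) ℂ}
    (hx : (fromBlocks 0 B C 0 : Matrix (Fin 2 ⊕ Fin 2) (Fin 2 ⊕ Fin 2) ℂ)ᴴ * Matrix.J (Fin 2) ℂ * (fromBlocks 0 B C 0 : Matrix (Fin 2 ⊕ Fin 2) (Fin 2 ⊕ Fin 2) ℂ) =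
      Matrix.J (Fin 2) ℂ)
    {g : Matrix (Fin 2 ⊕ Fin 2) (Fin 2 ⊕ Fin 2) ℂ} (hg : gᴴ * Matrix.J (Fin 2) ℂ * g = Matrix.J (Fin 2) ℂ)
    {hidx : Matrix (Fin 2) (Fin 2) ℂ} (hh : hidxᴴ = hidx) {eb : Matrix (Fin 2) (Fin 2) ℂ → ℂ} (heb : ∀ b, eb b = cexp (-(2 * Real.pi * I) * (hidx * b).trace)) :
    Integrable (fun r : Fin 2 → Fin 2 → ℝ => F ((fromBlocks 0 B C 0 : Matrix (Fin 2 ⊕ Fin 2) (Fin 2 ⊕ Fin 2) ℂ) * fromBlocks 1 (hermOfReal r) 0 1 * g) * eb (hermOfReal r)) := by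
  have hebfun : (fun r : Fin 2 → Fin 2 → ℝ => eb (hermOfReal r)) = fun r => cexp (-(2 * Real.pi * I) * (hidx * hermOfReal r).trace) := funext fun r => heb _
  have hcont : Continuous fun r : Fin 2 → Fin 2 → ℝ => eb (hermOfReal r) := by
    rw [hebfun]
    exact Complex.continuous_exp.comp (continuous_const.mul ((continuous_const.matrix_mul K2LiuArchUnipotentFrameCoordinates.continuous_hermOfReal).matrix_trace))
  refine (integrable_antidiag_transl k hs hF Q hFQ hx hg).mul_bdd (c := 1) hcont.aestronglyMeasurable (Filter.Eventually.of_forall fun r => ?_)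
  rw [heb, norm_cexp_trace_hermOfReal hh]

/-- **(3d-iv) GROWTH CONSTANTS UNIFORM OVER THE STABILISER.**  From an AT-ONE letter `hAtOne` (constants uniform on the Siegel-form locus, for every picture predicate
with polynomial `K`-translates; `sgn` any sign condition implying hermitian) to the `u₀`-FACE letter of ★ `hWgrU_of_record` for the Cayley picture `Q`: for every `z`
with `0 < re z` ONE set of constants `Cg cg N N′ r` such that every datum `(hidx, eb, g)` (`sgn hidx`, `eb = e(−tr(hidx·))`, `g ∈ U(J)`) carries a continuation `Ew`,
holomorphic on `{0 < re s}`, equal to the twisted unipotent integral of every `Q`-section on a right half-plane, and bounded by the (ii″) face at EVERY hermitian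
Iwasawa decomposition `diag(C, −B)·g = n(X₀)·diag(R, R⁻¹)·u₀`, `u₀ ∈ K`.  [cite: Shimura1997, §16.4, §18.4] [cite: KudlaRallis1994, §1] -/
theorem stabUniform_of_atOne (k : ℤ) (sgn : Matrix (Fin 2) (Fin 2) ℂ → Prop) (hsgn : ∀ h, sgn h → hᴴ = h) (Q : Carrier)
    {B C : Matrix (Fin 2) (Fin 2) ℂ}
    (hx : (fromBlocks 0 B C 0 : Matrix (Fin 2 ⊕ Fin 2) (Fin 2 ⊕ Fin 2) ℂ)ᴴ * Matrix.J (Fin 2) ℂ * (fromBlocks 0 B C 0 : Matrix (Fin 2 ⊕ Fin 2) (Fin 2 ⊕ Fin 2) ℂ) =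
      Matrix.J (Fin 2) ℂ)
    (hAtOne : ∀ Pic : ℂ → (Matrix (Fin 2 ⊕ Fin 2) (Fin 2 ⊕ Fin 2) ℂ → ℂ) → Prop,
      (∀ k₀ : Matrix (Fin 2 ⊕ Fin 2) (Fin 2 ⊕ Fin 2) ℂ, k₀ᴴ * Matrix.J (Fin 2) ℂ * k₀ = Matrix.J (Fin 2) ℂ →
        moeb k₀ (I • (1 : Matrix (Fin 2) (Fin 2) ℂ)) = I • 1 →
        ∃ P : MvPolynomial (((Fin 2 ⊕ Fin 2) × (Fin 2 ⊕ Fin 2)) ⊕ ((Fin 2 ⊕ Fin 2) × (Fin 2 ⊕ Fin 2))) ℂ,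
          ∀ (s : ℂ) (F : Matrix (Fin 2 ⊕ Fin 2) (Fin 2 ⊕ Fin 2) ℂ → ℂ), IsArchSiegelSection (fun z : ℂ => (conj z / ((‖z‖ : ℝ) : ℂ)) ^ k) s F →
            Pic s F →
            ∀ u : Matrix (Fin 2 ⊕ Fin 2) (Fin 2 ⊕ Fin 2) ℂ, uᴴ * Matrix.J (Fin 2) ℂ * u = Matrix.J (Fin 2) ℂ →
              moeb u (I • (1 : Matrix (Fin 2) (Fin 2) ℂ)) = I • 1 →
              F (u * k₀) = MvPolynomial.eval (Sum.elim (fun pq => u pq.1 pq.2) (fun pq => conj (u pq.1 pq.2))) P) →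
      ∃ Ew : Matrix (Fin 2) (Fin 2) ℂ → Matrix (Fin 2 ⊕ Fin 2) (Fin 2 ⊕ Fin 2) ℂ → ℂ → ℂ,
        (∀ hidx : Matrix (Fin 2) (Fin 2) ℂ, sgn hidx → ∀ eb : Matrix (Fin 2) (Fin 2) ℂ → ℂ, (∀ b, eb b = cexp (-(2 * Real.pi * I) * (hidx * b).trace)) →
          ∀ g : Matrix (Fin 2 ⊕ Fin 2) (Fin 2 ⊕ Fin 2) ℂ, gᴴ * Matrix.J (Fin 2) ℂ * g = Matrix.J (Fin 2) ℂ →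
          DifferentiableOn ℂ (Ew hidx g) {s : ℂ | 0 < s.re} ∧
          ∃ s₀ : ℝ, ∀ s : ℂ, s₀ < s.re →
            ∀ F : Matrix (Fin 2 ⊕ Fin 2) (Fin 2 ⊕ Fin 2) ℂ → ℂ, IsArchSiegelSection (fun z : ℂ => (conj z / ((‖z‖ : ℝ) : ℂ)) ^ k) s F → Pic s F →
              ∫ r : Fin 2 → Fin 2 → ℝ, F ((fromBlocks 0 B C 0 : Matrix (Fin 2 ⊕ Fin 2) (Fin 2 ⊕ Fin 2) ℂ) * fromBlocks 1 (hermOfReal r) 0 1 * g) * eb (hermOfReal r) =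
                Ew hidx g s) ∧
        ∀ z : ℂ, 0 < z.re → ∃ Cg cg N N' r : ℝ, 0 ≤ Cg ∧ 0 < cg ∧ 0 ≤ N ∧ 0 ≤ N' ∧ 0 < r ∧
          ∀ hidx : Matrix (Fin 2) (Fin 2) ℂ, sgn hidx → ∀ eb : Matrix (Fin 2) (Fin 2) ℂ → ℂ, (∀ b, eb b = cexp (-(2 * Real.pi * I) * (hidx * b).trace)) →
          ∀ g : Matrix (Fin 2 ⊕ Fin 2) (Fin 2 ⊕ Fin 2) ℂ, gᴴ * Matrix.J (Fin 2) ℂ * g = Matrix.J (Fin 2) ℂ →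
            ∀ (X₀ R : Matrix (Fin 2) (Fin 2) ℂ), X₀ᴴ = X₀ → Rᴴ = R → IsUnit R.det →
              (fromBlocks C 0 0 (-B) : Matrix (Fin 2 ⊕ Fin 2) (Fin 2 ⊕ Fin 2) ℂ) * g = fromBlocks 1 X₀ 0 1 * fromBlocks R 0 0 R⁻¹ →
              ∀ s : ℂ, dist s z < r →
                ‖Ew hidx g s‖ ≤ Cg * ‖R.det‖ ^ (2 - 2 * s.re) * Real.exp (-(cg * ∑ a, ∑ b, ‖(R * ((C⁻¹)ᴴ * hidx * C⁻¹) * R) a b‖)) *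
                  (1 + ∑ a, ∑ b, ‖(R * ((C⁻¹)ᴴ * hidx * C⁻¹) * R) a b‖) ^ N * (1 + ‖(R * ((C⁻¹)ᴴ * hidx * C⁻¹) * R).det‖ ^ (-N'))) :
    ∀ z : ℂ, 0 < z.re → ∃ Cg cg N N' r : ℝ, 0 ≤ Cg ∧ 0 < cg ∧ 0 ≤ N ∧ 0 ≤ N' ∧ 0 < r ∧
      ∀ hidx : Matrix (Fin 2) (Fin 2) ℂ, sgn hidx → ∀ eb : Matrix (Fin 2) (Fin 2) ℂ → ℂ, (∀ b, eb b = cexp (-(2 * Real.pi * I) * (hidx * b).trace)) →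
      ∀ g : Matrix (Fin 2 ⊕ Fin 2) (Fin 2 ⊕ Fin 2) ℂ, gᴴ * Matrix.J (Fin 2) ℂ * g = Matrix.J (Fin 2) ℂ →
        ∃ (Ew : ℂ → ℂ) (s₀ : ℝ), DifferentiableOn ℂ Ew {s : ℂ | 0 < s.re} ∧
          (∀ s : ℂ, s₀ < s.re → ∀ F : Matrix (Fin 2 ⊕ Fin 2) (Fin 2 ⊕ Fin 2) ℂ → ℂ, IsArchSiegelSection (fun z : ℂ => (conj z / ((‖z‖ : ℝ) : ℂ)) ^ k) s F →
            (∀ (v : Matrix (Fin 2) (Fin 2) ℂ), vᴴ * v = 1 → ∀ hv : v.det ≠ 0,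
              F ((2 : ℂ)⁻¹ • fromBlocks (1 + v) (-(I • (1 - v))) (I • (1 - v)) (1 + v) : Matrix (Fin 2 ⊕ Fin 2) (Fin 2 ⊕ Fin 2) ℂ) = evalAt v hv Q) →
            ∫ x : Fin 2 → Fin 2 → ℝ, F ((fromBlocks 0 B C 0 : Matrix (Fin 2 ⊕ Fin 2) (Fin 2 ⊕ Fin 2) ℂ) * fromBlocks 1 (hermOfReal x) 0 1 * g) *
              eb (hermOfReal x) = Ew s) ∧
          ∀ s : ℂ, dist s z < r →
            ∀ (X₀ R : Matrix (Fin 2) (Fin 2) ℂ) (u₀ : Matrix (Fin 2 ⊕ Fin 2) (Fin 2 ⊕ Fin 2) ℂ), X₀ᴴ = X₀ → Rᴴ = R → IsUnit R.det →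
              u₀ᴴ * Matrix.J (Fin 2) ℂ * u₀ = Matrix.J (Fin 2) ℂ → moeb u₀ (I • (1 : Matrix (Fin 2) (Fin 2) ℂ)) = I • 1 →
              (fromBlocks C 0 0 (-B) : Matrix (Fin 2 ⊕ Fin 2) (Fin 2 ⊕ Fin 2) ℂ) * g = fromBlocks 1 X₀ 0 1 * fromBlocks R 0 0 R⁻¹ * u₀ →
              ‖Ew s‖ ≤ Cg * ‖R.det‖ ^ (2 - 2 * s.re) * Real.exp (-(cg * ∑ a, ∑ b, ‖(R * ((C⁻¹)ᴴ * hidx * C⁻¹) * R) a b‖)) *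
                (1 + ∑ a, ∑ b, ‖(R * ((C⁻¹)ᴴ * hidx * C⁻¹) * R) a b‖) ^ N * (1 + ‖(R * ((C⁻¹)ᴴ * hidx * C⁻¹) * R).det‖ ^ (-N')) := by
  classical
  intro z hz
  /- ## Step 0: the stabiliser, the `K`-picture polynomial `P₁` of the `Q`-sections, the translate pictures `φ` -/
  set K : Set (Matrix (Fin 2 ⊕ Fin 2) (Fin 2 ⊕ Fin 2) ℂ) :=
    {u | uᴴ * Matrix.J (Fin 2) ℂ * u = Matrix.J (Fin 2) ℂ ∧ moeb u (I • (1 : Matrix (Fin 2) (Fin 2) ℂ)) = I • 1} with hKdef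
  have hK : IsCompact K := isCompact_stab
  obtain ⟨P₁, hP₁⟩ := kPicture_rightTranslate k Q 1 (stab_one (l := Fin 2)).1 (stab_one (l := Fin 2)).2
  -- `φ k₀ u = P₁(u·k₀)`, the `K`-picture of the `k₀`-translate of any `Q`-section
  set φ : Matrix (Fin 2 ⊕ Fin 2) (Fin 2 ⊕ Fin 2) ℂ → Matrix (Fin 2 ⊕ Fin 2) (Fin 2 ⊕ Fin 2) ℂ → ℂ := fun k₀ u =>
    MvPolynomial.eval (Sum.elim (fun pq : (Fin 2 ⊕ Fin 2) × (Fin 2 ⊕ Fin 2) => (u * k₀) pq.1 pq.2) (fun pq => conj ((u * k₀) pq.1 pq.2))) P₁ with hφ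
  have hφF : ∀ (s : ℂ) (F : Matrix (Fin 2 ⊕ Fin 2) (Fin 2 ⊕ Fin 2) ℂ → ℂ), IsArchSiegelSection (fun z : ℂ => (conj z / ((‖z‖ : ℝ) : ℂ)) ^ k) s F →
      (∀ (v : Matrix (Fin 2) (Fin 2) ℂ), vᴴ * v = 1 → ∀ hv : v.det ≠ 0,
        F ((2 : ℂ)⁻¹ • fromBlocks (1 + v) (-(I • (1 - v))) (I • (1 - v)) (1 + v) : Matrix (Fin 2 ⊕ Fin 2) (Fin 2 ⊕ Fin 2) ℂ) = evalAt v hv Q) →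
      ∀ u k₀ : Matrix (Fin 2 ⊕ Fin 2) (Fin 2 ⊕ Fin 2) ℂ, u ∈ K → k₀ ∈ K → F (u * k₀) = φ k₀ u := by
    intro s F hF hFQ u k₀ hu hk₀
    have h := hP₁ s F hF hFQ (u * k₀) (stab_mul hu.1 hu.2 hk₀.1 hk₀.2).1 (stab_mul hu.1 hu.2 hk₀.1 hk₀.2).2
    rwa [Matrix.mul_one] at h
  /- ## Step 1: the span of the translate pictures is finite-dimensional; basis with bounded coefficients on `K` -/
  set V : Submodule ℂ (Matrix (Fin 2 ⊕ Fin 2) (Fin 2 ⊕ Fin 2) ℂ → ℂ) := Submodule.span ℂ (φ '' K) with hVdef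
  -- the evaluation map `P ↦ (u ↦ P(u))` and the degree-`≤ deg P₁` window
  set evL : MvPolynomial (((Fin 2 ⊕ Fin 2) × (Fin 2 ⊕ Fin 2)) ⊕ ((Fin 2 ⊕ Fin 2) × (Fin 2 ⊕ Fin 2))) ℂ →ₗ[ℂ]
      (Matrix (Fin 2 ⊕ Fin 2) (Fin 2 ⊕ Fin 2) ℂ → ℂ) :=
    LinearMap.pi fun u : Matrix (Fin 2 ⊕ Fin 2) (Fin 2 ⊕ Fin 2) ℂ =>
      (MvPolynomial.aeval (Sum.elim (fun pq : (Fin 2 ⊕ Fin 2) × (Fin 2 ⊕ Fin 2) => u pq.1 pq.2) (fun pq => conj (u pq.1 pq.2)))).toLinearMap with hevL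
  have hφW : ∀ k₀, φ k₀ ∈ (MvPolynomial.restrictTotalDegree _ ℂ P₁.totalDegree).map evL := by
    intro k₀
    refine Submodule.mem_map.2 ⟨_, (MvPolynomial.mem_restrictTotalDegree _ _ _).2 (totalDegree_bind₁_translate_le P₁ k₀), ?_⟩
    funext u
    rw [hevL, LinearMap.pi_apply, AlgHom.toLinearMap_apply, MvPolynomial.aeval_eq_eval]
    exact eval_bind₁_translate P₁ u k₀
  haveI : FiniteDimensional ℂ V :=
    Submodule.finiteDimensional_of_le (Submodule.span_le.2 (by rintro _ ⟨k₀, -, rfl⟩; exact hφW k₀))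
  obtain ⟨d, G, a, Ma, hMa0, hGV, hspan, hMa⟩ := exists_basis_coeff_bound V hK φ (fun u hu => Submodule.subset_span ⟨u, hu, rfl⟩)
    (fun x => (continuous_eval_translate P₁ x).continuousOn)
  -- each basis vector is a finite combination of translate pictures
  have hGspan : ∀ i : Fin d, ∃ (n : ℕ) (f : Fin n → ℂ) (κ : Fin n → Matrix (Fin 2 ⊕ Fin 2) (Fin 2 ⊕ Fin 2) ℂ),
      (∀ m, κ m ∈ K) ∧ G i = ∑ m, f m • φ (κ m) := by
    intro i
    obtain ⟨n, f, gs, hG⟩ := Submodule.mem_span_set'.1 (hGV i)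
    have hgs : ∀ m, ∃ κ, κ ∈ K ∧ φ κ = (gs m : Matrix (Fin 2 ⊕ Fin 2) (Fin 2 ⊕ Fin 2) ℂ → ℂ) := fun m => (gs m).2
    choose κ hκK hκφ using hgs
    exact ⟨n, f, κ, hκK, by rw [← hG]; exact Finset.sum_congr rfl fun m _ => by rw [hκφ]⟩
  choose n f κ hκK hGf using hGspan
  -- the coefficient budget
  set Mf : ℝ := ∑ i, ∑ m, ‖f i m‖ with hMf
  have hMf0 : 0 ≤ Mf := Finset.sum_nonneg fun i _ => Finset.sum_nonneg fun m _ => norm_nonneg _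
  have hfle : ∀ i, ∑ m, ‖f i m‖ ≤ Mf := fun i => le_sum_univ (f := fun i => ∑ m, ‖f i m‖) (fun i => Finset.sum_nonneg fun m _ => norm_nonneg _) i
  -- the translate relation on `K`: `φ u₀ x = Σ_{i,m} a u₀ i · f i m · φ (κ i m) x`
  have hrel : ∀ u₀ ∈ K, ∀ x, φ u₀ x = ∑ j : (Σ i : Fin d, Fin (n i)), (a u₀ j.1 * f j.1 j.2) * φ (κ j.1 j.2) x := by
    intro u₀ hu₀ x
    rw [hspan u₀ hu₀]
    simp only
    rw [Fintype.sum_sigma]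
    refine Finset.sum_congr rfl fun i _ => ?_
    have hi := congrFun (hGf i) x
    simp only [Finset.sum_apply, Pi.smul_apply, smul_eq_mul] at hi
    rw [hi, Finset.mul_sum]
    exact Finset.sum_congr rfl fun m _ => by ring
  have hcoef : ∀ u₀ ∈ K, ∑ j : (Σ i : Fin d, Fin (n i)), ‖a u₀ j.1 * f j.1 j.2‖ ≤ Ma * Mf := by
    intro u₀ hu₀
    rw [Fintype.sum_sigma]
    calc ∑ i, ∑ m, ‖a u₀ i * f i m‖ = ∑ i, ‖a u₀ i‖ * ∑ m, ‖f i m‖ := Finset.sum_congr rfl fun i _ => by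
            rw [Finset.mul_sum]; exact Finset.sum_congr rfl fun m _ => norm_mul _ _
      _ ≤ ∑ i, ‖a u₀ i‖ * Mf := Finset.sum_le_sum fun i _ => mul_le_mul_of_nonneg_left (hfle i) (norm_nonneg _)
      _ = (∑ i, ‖a u₀ i‖) * Mf := by rw [Finset.sum_mul]
      _ ≤ Ma * Mf := mul_le_mul_of_nonneg_right (hMa u₀ hu₀) hMf0
  /- ## Step 2: the basis letters — `hAtOne` at the translate predicates `Pic_j s F′ := ∃ F, F′ = F(·κ_j)` -/
  have hAtj : ∀ j : (Σ i : Fin d, Fin (n i)), ∃ Ew : Matrix (Fin 2) (Fin 2) ℂ → Matrix (Fin 2 ⊕ Fin 2) (Fin 2 ⊕ Fin 2) ℂ → ℂ → ℂ,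
      (∀ hidx : Matrix (Fin 2) (Fin 2) ℂ, sgn hidx → ∀ eb : Matrix (Fin 2) (Fin 2) ℂ → ℂ, (∀ b, eb b = cexp (-(2 * Real.pi * I) * (hidx * b).trace)) →
        ∀ g : Matrix (Fin 2 ⊕ Fin 2) (Fin 2 ⊕ Fin 2) ℂ, gᴴ * Matrix.J (Fin 2) ℂ * g = Matrix.J (Fin 2) ℂ →
        DifferentiableOn ℂ (Ew hidx g) {s : ℂ | 0 < s.re} ∧
        ∃ s₀ : ℝ, ∀ s : ℂ, s₀ < s.re →
          ∀ F' : Matrix (Fin 2 ⊕ Fin 2) (Fin 2 ⊕ Fin 2) ℂ → ℂ, IsArchSiegelSection (fun z : ℂ => (conj z / ((‖z‖ : ℝ) : ℂ)) ^ k) s F' →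
            (∃ F : Matrix (Fin 2 ⊕ Fin 2) (Fin 2 ⊕ Fin 2) ℂ → ℂ, IsArchSiegelSection (fun z : ℂ => (conj z / ((‖z‖ : ℝ) : ℂ)) ^ k) s F ∧
              (∀ (v : Matrix (Fin 2) (Fin 2) ℂ), vᴴ * v = 1 → ∀ hv : v.det ≠ 0,
                F ((2 : ℂ)⁻¹ • fromBlocks (1 + v) (-(I • (1 - v))) (I • (1 - v)) (1 + v) : Matrix (Fin 2 ⊕ Fin 2) (Fin 2 ⊕ Fin 2) ℂ) = evalAt v hv Q) ∧
              F' = fun y => F (y * κ j.1 j.2)) →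
            ∫ r : Fin 2 → Fin 2 → ℝ, F' ((fromBlocks 0 B C 0 : Matrix (Fin 2 ⊕ Fin 2) (Fin 2 ⊕ Fin 2) ℂ) * fromBlocks 1 (hermOfReal r) 0 1 * g) * eb (hermOfReal r) =
              Ew hidx g s) ∧
      ∀ z : ℂ, 0 < z.re → ∃ Cg cg N N' r : ℝ, 0 ≤ Cg ∧ 0 < cg ∧ 0 ≤ N ∧ 0 ≤ N' ∧ 0 < r ∧
        ∀ hidx : Matrix (Fin 2) (Fin 2) ℂ, sgn hidx → ∀ eb : Matrix (Fin 2) (Fin 2) ℂ → ℂ, (∀ b, eb b = cexp (-(2 * Real.pi * I) * (hidx * b).trace)) →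
        ∀ g : Matrix (Fin 2 ⊕ Fin 2) (Fin 2 ⊕ Fin 2) ℂ, gᴴ * Matrix.J (Fin 2) ℂ * g = Matrix.J (Fin 2) ℂ →
          ∀ (X₀ R : Matrix (Fin 2) (Fin 2) ℂ), X₀ᴴ = X₀ → Rᴴ = R → IsUnit R.det →
            (fromBlocks C 0 0 (-B) : Matrix (Fin 2 ⊕ Fin 2) (Fin 2 ⊕ Fin 2) ℂ) * g = fromBlocks 1 X₀ 0 1 * fromBlocks R 0 0 R⁻¹ →
            ∀ s : ℂ, dist s z < r →
              ‖Ew hidx g s‖ ≤ Cg * ‖R.det‖ ^ (2 - 2 * s.re) * Real.exp (-(cg * ∑ a, ∑ b, ‖(R * ((C⁻¹)ᴴ * hidx * C⁻¹) * R) a b‖)) *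
                (1 + ∑ a, ∑ b, ‖(R * ((C⁻¹)ᴴ * hidx * C⁻¹) * R) a b‖) ^ N * (1 + ‖(R * ((C⁻¹)ᴴ * hidx * C⁻¹) * R).det‖ ^ (-N')) := by
    intro j
    refine hAtOne _ fun k₀ hk₀ hk₀I => ?_
    obtain ⟨P, hP⟩ := kPicture_rightTranslate k Q (k₀ * κ j.1 j.2) (stab_mul hk₀ hk₀I (hκK j.1 j.2).1 (hκK j.1 j.2).2).1
      (stab_mul hk₀ hk₀I (hκK j.1 j.2).1 (hκK j.1 j.2).2).2
    refine ⟨P, fun s F' _ hPic u hu huI => ?_⟩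
    obtain ⟨F, hF, hFQ, rfl⟩ := hPic
    simp only
    rw [Matrix.mul_assoc]
    exact hP s F hF hFQ u hu huI
  choose EwG hE1 hE2 using hAtj
  /- ## Step 3: the merged constants (★ §A `exists_uniform_of_finite_family` on the parameters `p = (hidx, g′, X₀, R)`) -/
  obtain ⟨Cg, cg, N, N', r, hCg, hcg, hN, hN', hr, hM⟩ := exists_uniform_of_finite_family (ι := (Σ i : Fin d, Fin (n i)))
    (P := Matrix (Fin 2) (Fin 2) ℂ × Matrix (Fin 2 ⊕ Fin 2) (Fin 2 ⊕ Fin 2) ℂ × Matrix (Fin 2) (Fin 2) ℂ × Matrix (Fin 2) (Fin 2) ℂ)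
    (fun p => sgn p.1 ∧ p.2.1ᴴ * Matrix.J (Fin 2) ℂ * p.2.1 = Matrix.J (Fin 2) ℂ ∧ p.2.2.1ᴴ = p.2.2.1 ∧ p.2.2.2ᴴ = p.2.2.2 ∧ IsUnit p.2.2.2.det ∧
      (fromBlocks C 0 0 (-B) : Matrix (Fin 2 ⊕ Fin 2) (Fin 2 ⊕ Fin 2) ℂ) * p.2.1 = fromBlocks 1 p.2.2.1 0 1 * fromBlocks p.2.2.2 0 0 p.2.2.2⁻¹)
    (fun p => ‖p.2.2.2.det‖) (fun p => ∑ a, ∑ b, ‖(p.2.2.2 * ((C⁻¹)ᴴ * p.1 * C⁻¹) * p.2.2.2) a b‖)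
    (fun p => ‖(p.2.2.2 * ((C⁻¹)ᴴ * p.1 * C⁻¹) * p.2.2.2).det‖)
    (fun p _ => norm_nonneg _) (fun p _ => Finset.sum_nonneg fun a _ => Finset.sum_nonneg fun b _ => norm_nonneg _) (fun p _ => norm_nonneg _)
    (fun j p => EwG j p.1 p.2.1)
    (fun j z' hz' => by
      obtain ⟨Cg, cg, N, N', r, hCg, hcg, hN, hN', hr, hB⟩ := hE2 j z' hz'
      exact ⟨Cg, cg, N, N', r, hCg, hcg, hN, hN', hr, fun s hs p hp =>
        hB p.1 hp.1 (fun b => cexp (-(2 * Real.pi * I) * (p.1 * b).trace)) (fun b => rfl) p.2.1 hp.2.1 p.2.2.1 p.2.2.2 hp.2.2.1 hp.2.2.2.1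
          hp.2.2.2.2.1 hp.2.2.2.2.2 s hs⟩)
    (mul_nonneg hMa0 hMf0) z hz
  refine ⟨Cg * 4 ^ N, cg / 4, N, N', r, by positivity, by positivity, hN, hN', hr, fun hidx hsg eb heb g hg => ?_⟩
  /- ## Step 4: one datum `(hidx, eb, g)` — choose the decomposition, define `Ew` -/
  have hh : hidxᴴ = hidx := hsgn hidx hsg
  have hdiag : (fromBlocks C 0 0 (-B) : Matrix (Fin 2 ⊕ Fin 2) (Fin 2 ⊕ Fin 2) ℂ)ᴴ * Matrix.J (Fin 2) ℂ * fromBlocks C 0 0 (-B) = Matrix.J (Fin 2) ℂ :=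
    levi_mem (antidiag_letters hx).2
  obtain ⟨X₀, R, u₀, hX₀, hR, hRu, hu₀, hu₀I, hdec⟩ := exists_transl_levi_mul_stabilizer (mul_mem_UJ hdiag hg)
  have hu₀K : u₀ ∈ K := ⟨hu₀, hu₀I⟩
  set g' : Matrix (Fin 2 ⊕ Fin 2) (Fin 2 ⊕ Fin 2) ℂ := g * u₀ᴴ with hg'def
  have hg' : g'ᴴ * Matrix.J (Fin 2) ℂ * g' = Matrix.J (Fin 2) ℂ := mul_mem_UJ hg (stab_conjTranspose hu₀ hu₀I).1
  have hgg' : g = g' * u₀ := by rw [hg'def, Matrix.mul_assoc, conjTranspose_mul_of_stab hu₀ hu₀I, Matrix.mul_one]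
  have hdec' : (fromBlocks C 0 0 (-B) : Matrix (Fin 2 ⊕ Fin 2) (Fin 2 ⊕ Fin 2) ℂ) * g' = fromBlocks 1 X₀ 0 1 * fromBlocks R 0 0 R⁻¹ := by
    rw [hg'def, ← Matrix.mul_assoc, hdec, Matrix.mul_assoc, mul_conjTranspose_of_stab hu₀ hu₀I, Matrix.mul_one]
  -- the coefficients at `u₀` and the continuation
  set c : (Σ i : Fin d, Fin (n i)) → ℂ := fun j => a u₀ j.1 * f j.1 j.2 with hcdef
  have hc : ∑ j, ‖c j‖ ≤ Ma * Mf := hcoef u₀ hu₀K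
  have h1 : ∀ j, DifferentiableOn ℂ (EwG j hidx g') {s : ℂ | 0 < s.re} ∧ ∃ s₀ : ℝ, _ := fun j => hE1 j hidx hsg eb heb g' hg'
  choose s₀j hform using fun j => (h1 j).2
  refine ⟨fun s => ∑ j, c j * EwG j hidx g' s, max (1 / 2) (∑ j, |s₀j j|),
    DifferentiableOn.fun_sum fun j _ => ((h1 j).1).const_mul (c j), fun s hs F hF hFQ => ?_,
    fun s hs X₁ R₁ u₁ hX₁ hR₁ hR₁u hu₁ hu₁I hdec₁ => ?_⟩
  · /- ## Step 5: the FORMULA — split `F(·u₀)` along the finite span and integrate term by term -/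
    have hs12 : 1 / 2 < s.re := lt_of_le_of_lt (le_max_left _ _) hs
    have hsj : ∀ j, s₀j j < s.re := fun j =>
      lt_of_le_of_lt ((le_abs_self _).trans ((le_sum_univ (f := fun j => |s₀j j|) (fun j => abs_nonneg _) j).trans (le_max_right _ _))) hs
    -- the two sections `F(·u₀)` and `Σ_j c_j F(·κ_j)` have the same `K`-picture
    have hlin : ∀ y : Matrix (Fin 2 ⊕ Fin 2) (Fin 2 ⊕ Fin 2) ℂ, yᴴ * Matrix.J (Fin 2) ℂ * y = Matrix.J (Fin 2) ℂ →
        F (y * u₀) = ∑ j, c j * F (y * κ j.1 j.2) := by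
      intro y hy
      refine eq_of_isArchSiegelSection_of_eqOn_stab (f := fun y => F (y * u₀)) (f' := fun y => ∑ j, c j * F (y * κ j.1 j.2))
        (isArchSiegelSection_rightTranslate hF u₀)
        (isArchSiegelSection_sum_mul_rightTranslate Finset.univ hF c fun j : (Σ i : Fin d, Fin (n i)) => κ j.1 j.2) ?_ hy
      intro u hu huI
      rw [hφF s F hF hFQ u u₀ ⟨hu, huI⟩ hu₀K, hrel u₀ hu₀K u]
      exact Finset.sum_congr rfl fun j _ => by rw [hφF s F hF hFQ u (κ j.1 j.2) ⟨hu, huI⟩ (hκK j.1 j.2)]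
    -- integrability of every summand
    have hint : ∀ j : (Σ i : Fin d, Fin (n i)), Integrable (fun r : Fin 2 → Fin 2 → ℝ =>
        F ((fromBlocks 0 B C 0 : Matrix (Fin 2 ⊕ Fin 2) (Fin 2 ⊕ Fin 2) ℂ) * fromBlocks 1 (hermOfReal r) 0 1 * g' * κ j.1 j.2) * eb (hermOfReal r)) := by
      intro j
      have h := integrable_twisted k hs12 hF Q hFQ hx (mul_mem_UJ hg' (hκK j.1 j.2).1) hh heb
      simpa only [Matrix.mul_assoc] using h
    -- the computation
    have hpt : ∀ r : Fin 2 → Fin 2 → ℝ,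
        F ((fromBlocks 0 B C 0 : Matrix (Fin 2 ⊕ Fin 2) (Fin 2 ⊕ Fin 2) ℂ) * fromBlocks 1 (hermOfReal r) 0 1 * g) * eb (hermOfReal r) =
          ∑ j, c j * (F ((fromBlocks 0 B C 0 : Matrix (Fin 2 ⊕ Fin 2) (Fin 2 ⊕ Fin 2) ℂ) * fromBlocks 1 (hermOfReal r) 0 1 * g' * κ j.1 j.2) * eb (hermOfReal r)) := by
      intro r
      rw [hgg', ← Matrix.mul_assoc,
        hlin _ (mul_mem_UJ (mul_mem_UJ hx ((transl_mem_iff (hermOfReal r)).2 (conjTranspose_hermOfReal r))) hg'), Finset.sum_mul]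
      exact Finset.sum_congr rfl fun j _ => by ring
    calc ∫ r : Fin 2 → Fin 2 → ℝ, F ((fromBlocks 0 B C 0 : Matrix (Fin 2 ⊕ Fin 2) (Fin 2 ⊕ Fin 2) ℂ) * fromBlocks 1 (hermOfReal r) 0 1 * g) * eb (hermOfReal r)
        = ∫ r : Fin 2 → Fin 2 → ℝ, ∑ j, c j * (F ((fromBlocks 0 B C 0 : Matrix (Fin 2 ⊕ Fin 2) (Fin 2 ⊕ Fin 2) ℂ) * fromBlocks 1 (hermOfReal r) 0 1 * g' * κ j.1 j.2) *
            eb (hermOfReal r)) := by simp_rw [hpt]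
      _ = ∑ j, ∫ r : Fin 2 → Fin 2 → ℝ, c j * (F ((fromBlocks 0 B C 0 : Matrix (Fin 2 ⊕ Fin 2) (Fin 2 ⊕ Fin 2) ℂ) * fromBlocks 1 (hermOfReal r) 0 1 * g' * κ j.1 j.2) *
            eb (hermOfReal r)) := integral_finsetSum _ fun j _ => (hint j).const_mul (c j)
      _ = ∑ j, c j * EwG j hidx g' s := Finset.sum_congr rfl fun j _ => by
          rw [integral_const_mul]
          congr 1
          exact hform j s (hsj j) (fun y => F (y * κ j.1 j.2)) (isArchSiegelSection_rightTranslate hF _) ⟨F, hF, hFQ, rfl⟩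
  · /- ## Step 6: the BOUND — uniform letter at `(hidx, g′, X₀, R)`, then transport `R ↦ R₁` through ★ `levi_letters_unique` -/
    have hM' := hM c hc s hs ⟨hidx, g', X₀, R⟩ ⟨hsg, hg', hX₀, hR, hRu, hdec'⟩
    simp only at hM'
    -- the two decompositions of `diag(C, −B)·g` differ by a unitary `κ₁`: `R = R₁·κ₁`
    obtain ⟨κ₁, hκ1, hκ2, hRκ⟩ := levi_letters_unique hR₁u hu₀ hu₀I hu₁ hu₁I (hdec.symm.trans hdec₁)
    have hRκ' : R = κ₁ᴴ * R₁ := by rw [← hR, hRκ, conjTranspose_mul, hR₁]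
    have hR₁κ : R₁ = R * κ₁ᴴ := by rw [hRκ, Matrix.mul_assoc, hκ2, Matrix.mul_one]
    have hR₁κ' : R₁ = κ₁ * R := by rw [← hR₁, hR₁κ, conjTranspose_mul, conjTranspose_conjTranspose, hR]
    set h₁ : Matrix (Fin 2) (Fin 2) ℂ := (C⁻¹)ᴴ * hidx * C⁻¹ with hh₁
    have hconj : R * h₁ * R = κ₁ᴴ * (R₁ * h₁ * R₁) * κ₁ := by
      calc R * h₁ * R = κ₁ᴴ * R₁ * h₁ * (R₁ * κ₁) := by rw [← hRκ', ← hRκ]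
        _ = κ₁ᴴ * (R₁ * h₁ * R₁) * κ₁ := by simp only [Matrix.mul_assoc]
    have hconj' : R₁ * h₁ * R₁ = κ₁ᴴᴴ * (R * h₁ * R) * κ₁ᴴ := by
      rw [conjTranspose_conjTranspose]
      calc R₁ * h₁ * R₁ = κ₁ * R * h₁ * (R * κ₁ᴴ) := by rw [← hR₁κ', ← hR₁κ]
        _ = κ₁ * (R * h₁ * R) * κ₁ᴴ := by simp only [Matrix.mul_assoc]
    have hκ1' : κ₁ᴴᴴ * κ₁ᴴ = 1 := by rw [conjTranspose_conjTranspose, hκ2]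
    -- the face data
    have hdet : ‖R.det‖ = ‖R₁.det‖ := by rw [hRκ, det_mul, norm_mul, norm_det_of_unitary hκ1, mul_one]
    have hD : ‖(R * h₁ * R).det‖ = ‖(R₁ * h₁ * R₁).det‖ := by rw [hconj, norm_det_unitary_conj _ hκ1]
    have hT : ∑ a, ∑ b, ‖(R * h₁ * R) a b‖ ≤ 4 * ∑ a, ∑ b, ‖(R₁ * h₁ * R₁) a b‖ := by rw [hconj]; exact entrySum_unitary_conj_le _ hκ1
    have hT' : ∑ a, ∑ b, ‖(R₁ * h₁ * R₁) a b‖ ≤ 4 * ∑ a, ∑ b, ‖(R * h₁ * R) a b‖ := by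
      have h := entrySum_unitary_conj_le (R * h₁ * R) hκ1'
      rwa [← hconj'] at h
    have hT0 : 0 ≤ ∑ a, ∑ b, ‖(R * h₁ * R) a b‖ := Finset.sum_nonneg fun a _ => Finset.sum_nonneg fun b _ => norm_nonneg _
    have hT0' : 0 ≤ ∑ a, ∑ b, ‖(R₁ * h₁ * R₁) a b‖ := Finset.sum_nonneg fun a _ => Finset.sum_nonneg fun b _ => norm_nonneg _
    have hexp := exp_neg_mul_le_of_le_mul (cg := cg) (by norm_num : (0 : ℝ) < 4) hcg.le hT'
    have hpow := one_add_rpow_le_of_le_mul (N := N) (by norm_num : (1 : ℝ) ≤ 4) hT0 hT0' hT hN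
    have hA : 0 ≤ Cg * ‖R₁.det‖ ^ (2 - 2 * s.re) := mul_nonneg hCg (Real.rpow_nonneg (norm_nonneg _) _)
    have hDf : 0 ≤ 1 + ‖(R₁ * h₁ * R₁).det‖ ^ (-N') := by have := Real.rpow_nonneg (norm_nonneg (R₁ * h₁ * R₁).det) (-N'); linarith
    calc ‖∑ j, c j * EwG j hidx g' s‖
        ≤ Cg * ‖R.det‖ ^ (2 - 2 * s.re) * Real.exp (-(cg * ∑ a, ∑ b, ‖(R * h₁ * R) a b‖)) * (1 + ∑ a, ∑ b, ‖(R * h₁ * R) a b‖) ^ N *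
            (1 + ‖(R * h₁ * R).det‖ ^ (-N')) := hM'
      _ = Cg * ‖R₁.det‖ ^ (2 - 2 * s.re) * Real.exp (-(cg * ∑ a, ∑ b, ‖(R * h₁ * R) a b‖)) * (1 + ∑ a, ∑ b, ‖(R * h₁ * R) a b‖) ^ N *
            (1 + ‖(R₁ * h₁ * R₁).det‖ ^ (-N')) := by rw [hdet, hD]
      _ ≤ Cg * ‖R₁.det‖ ^ (2 - 2 * s.re) * Real.exp (-(cg / 4 * ∑ a, ∑ b, ‖(R₁ * h₁ * R₁) a b‖)) *
            ((4 : ℝ) ^ N * (1 + ∑ a, ∑ b, ‖(R₁ * h₁ * R₁) a b‖) ^ N) * (1 + ‖(R₁ * h₁ * R₁).det‖ ^ (-N')) := by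
          gcongr
      _ = Cg * 4 ^ N * ‖R₁.det‖ ^ (2 - 2 * s.re) * Real.exp (-(cg / 4 * ∑ a, ∑ b, ‖(R₁ * h₁ * R₁) a b‖)) *
            (1 + ∑ a, ∑ b, ‖(R₁ * h₁ * R₁) a b‖) ^ N * (1 + ‖(R₁ * h₁ * R₁).det‖ ^ (-N')) := by ring

end Summit.HodgeConjecture.HodgeConjecture.Cruxes.HLiu418.K2LiuKindWArchGrowthStabUniform

end
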